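import Mathlib
import Literature.Computability.AlgebraicComplexity.GroupAlgebraTensor
import Literature.Computability.AlgebraicComplexity.MignonRessayreBound
import Summits.MatrixMultiplication.MatrixMultiplication.Theses.ProbeRankScaling
import Summits.MatrixMultiplication.MatrixMultiplication.Theorems.ProbeRankScalingPanTwoFoldToolkit

/-!
# MatrixMultiplication / ProbeRankScaling — support `PanTwoFold`
(stmt-MatrixMultiplication-7539)

Pan's two-fold trilinear aggregation, block-paired: an explicit bilinear algorithm for
`⟨2s, 2s, 2s⟩` over `ℂ` with `4 (s³ + 3 s²)` terms all of whose three legs ("probes"), read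
as `2s × 2s` matrices, have matrix rank `≤ 2`.

## The construction

Index rows and columns by `Fin 2 × Fin s` (block, position).  The trilinear form of
`⟨2s,2s,2s⟩` is `∑ z_{κν} x_{κμ} y_{μν} = ∑_{I,J,K} P(I,J,K)` with the eight block products
`P(I,J,K) = ∑_{i,j,k} z_{(I,i)(K,k)} x_{(I,i)(J,j)} y_{(J,j)(K,k)}`.  For each `(J, K)` the pair
`P(0,J,K) + P(1,J,K)` is produced by Pan's aggregation table (Pan 1984, (4.1)–(4.3) with
`m = n = p = s`): with `X1 i j = x_{(0,i)(J,j)}`, `U j k = x_{(1,j)(J,k)}`,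
`Y1 j k = y_{(J,j)(K,k)}`, `V k i = y_{(J,k)(K,i)}`, `Z1 i k = z_{(0,i)(K,k)}`,
`W j i = z_{(1,j)(K,i)}`,

  `∑_{ijk} (Z1 i k + W j i)(X1 i j + U j k)(Y1 j k + V k i)`            (`s³` aggregates)
  `- ∑_{ij} W j i · X1 i j · ∑_k (Y1 j k + V k i)`                      (`s²` corrections)
  `- ∑_{jk} (∑_i (Z1 i k + W j i)) · U j k · Y1 j k`                    (`s²` corrections)
  `- ∑_{ki} Z1 i k · (∑_j (X1 i j + U j k)) · V k i`                    (`s²` corrections)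
  `= ∑_{ijk} Z1 i k X1 i j Y1 j k + ∑_{ijk} W j i U j k V k i = P(0,J,K) + P(1,J,K)`,

an identity that already holds monomial by monomial.  Every leg is a matrix `a bᵀ + c dᵀ`
(two entries; one entry; a row segment plus a column segment), hence of rank `≤ 2`.

Proof organisation (helper lemmas in `ProbeRankScalingPanTwoFoldToolkit.lean`): a 3-tensor
over finite index sets is determined by its trilinear form (`tensor_eq_of_forall_trilinear_eq`,
`trilinear_sum_triad`, `trilinear_matMulTensorOn`); legs are written
`q ↦ (vecMulVec a b + vecMulVec c d) q.1 q.2` (or with one term), so the rank bound is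
`rank_vecMulVec_add_vecMulVec_le` and the linear forms are evaluated by
`sum_single_mul_single_mul` and its block variants; the four evaluated families of each pair
collapse by `pan_pair_identity`.  The decomposition is proved for
`matMulTensorOn ℂ (Fin 2 × Fin s) …` (`pan_core`) and transported to `matMulTensor ℂ (2s) …`
along `finProdFinEquiv` and an enumeration of the term index type (`panTwoFold_proof`).
No definitions are introduced (pure proof file).

References: V. Ya. Pan, *How can we speed up matrix multiplication?*, SIAM Review 26 (1984),
§4, (4.1)–(4.3); V. Ya. Pan, *Strassen's algorithm is not optimal*, FOCS 1978; V. Ya. Pan,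
*New fast algorithms for matrix operations*, SIAM J. Comput. 9 (1980).
-/

set_option linter.dupNamespace false

noncomputable section

open scoped BigOperators
open Matrix

namespace Summit.MatrixMultiplication.MatrixMultiplication.Theorems

open Literature.Computability.AlgebraicComplexity

/-! ## The block-paired two-fold aggregation algorithm -/

section Core

/-- **Pan's block-paired two-fold aggregation** on the index set `Fin 2 × Fin s`: the matrix
multiplication tensor is the sum, over the term index set, of the triads listed in the module
docstring (pair `(J, K) = (l.1, l.2.1)`: `s³` aggregates and `3 s²` corrections), and every leg
has matrix rank `≤ 2` (Pan 1984, (4.1)–(4.3), `m = n = p = s`). [folklore] -/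
theorem pan_core (s : ℕ) :
    ∃ w u v : (Fin 2 × Fin 2 × ((Fin s × Fin s × Fin s) ⊕ (Fin s × Fin s) ⊕ (Fin s × Fin s) ⊕
        (Fin s × Fin s))) → (Fin 2 × Fin s) × (Fin 2 × Fin s) → ℂ,
      matMulTensorOn ℂ (Fin 2 × Fin s) (Fin 2 × Fin s) (Fin 2 × Fin s) =
          ∑ l, triad (w l) (u l) (v l) ∧
        ∀ l, (Matrix.of (Function.curry (w l))).rank ≤ 2 ∧
          (Matrix.of (Function.curry (u l))).rank ≤ 2 ∧
          (Matrix.of (Function.curry (v l))).rank ≤ 2 := by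
  refine ⟨fun l => Sum.elim
      -- `z`-legs.  Aggregates `(i,j,k)`: `z_{(0,i)(K,k)} + z_{(1,j)(K,i)}`.
      (fun t q =>
        (vecMulVec (Pi.single ((0 : Fin 2), t.1) (1 : ℂ)) (Pi.single (l.2.1, t.2.2) (1 : ℂ)) +
          vecMulVec (Pi.single ((1 : Fin 2), t.2.1) (1 : ℂ)) (Pi.single (l.2.1, t.1) (1 : ℂ)))
          q.1 q.2)
      (Sum.elim
        -- corrections A `(i,j)`: `z_{(1,j)(K,i)}`
        (fun p q =>
          vecMulVec (Pi.single ((1 : Fin 2), p.2) (1 : ℂ)) (Pi.single (l.2.1, p.1) (1 : ℂ))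
            q.1 q.2)
        (Sum.elim
          -- corrections B `(j,k)`: `∑_i (z_{(0,i)(K,k)} + z_{(1,j)(K,i)})`
          (fun p q =>
            (vecMulVec
                ((Pi.single (0 : Fin 2) (1 : ℂ) : Fin 2 → ℂ) ∘ (Prod.fst : Fin 2 × Fin s → Fin 2))
                (Pi.single (l.2.1, p.2) (1 : ℂ)) +
              vecMulVec (Pi.single ((1 : Fin 2), p.1) (1 : ℂ))
                ((Pi.single l.2.1 (1 : ℂ) : Fin 2 → ℂ) ∘ (Prod.fst : Fin 2 × Fin s → Fin 2)))
              q.1 q.2)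
          -- corrections C `(k,i)`: `z_{(0,i)(K,k)}`
          (fun p q =>
            vecMulVec (Pi.single ((0 : Fin 2), p.2) (1 : ℂ)) (Pi.single (l.2.1, p.1) (1 : ℂ))
              q.1 q.2))) l.2.2,
    fun l => Sum.elim
      -- `x`-legs.  Aggregates `(i,j,k)`: `x_{(0,i)(J,j)} + x_{(1,j)(J,k)}`.
      (fun t q =>
        (vecMulVec (Pi.single ((0 : Fin 2), t.1) (1 : ℂ)) (Pi.single (l.1, t.2.1) (1 : ℂ)) +
          vecMulVec (Pi.single ((1 : Fin 2), t.2.1) (1 : ℂ)) (Pi.single (l.1, t.2.2) (1 : ℂ)))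
          q.1 q.2)
      (Sum.elim
        -- corrections A `(i,j)`: `- x_{(0,i)(J,j)}`
        (fun p q =>
          vecMulVec (Pi.single ((0 : Fin 2), p.1) (-1 : ℂ)) (Pi.single (l.1, p.2) (1 : ℂ))
            q.1 q.2)
        (Sum.elim
          -- corrections B `(j,k)`: `- x_{(1,j)(J,k)}`
          (fun p q =>
            vecMulVec (Pi.single ((1 : Fin 2), p.1) (-1 : ℂ)) (Pi.single (l.1, p.2) (1 : ℂ))
              q.1 q.2)
          -- corrections C `(k,i)`: `∑_j (x_{(0,i)(J,j)} + x_{(1,j)(J,k)})`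
          (fun p q =>
            (vecMulVec (Pi.single ((0 : Fin 2), p.2) (1 : ℂ))
                ((Pi.single l.1 (1 : ℂ) : Fin 2 → ℂ) ∘ (Prod.fst : Fin 2 × Fin s → Fin 2)) +
              vecMulVec
                ((Pi.single (1 : Fin 2) (1 : ℂ) : Fin 2 → ℂ) ∘ (Prod.fst : Fin 2 × Fin s → Fin 2))
                (Pi.single (l.1, p.1) (1 : ℂ)))
              q.1 q.2))) l.2.2,
    fun l => Sum.elim
      -- `y`-legs.  Aggregates `(i,j,k)`: `y_{(J,j)(K,k)} + y_{(J,k)(K,i)}`.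
      (fun t q =>
        (vecMulVec (Pi.single (l.1, t.2.1) (1 : ℂ)) (Pi.single (l.2.1, t.2.2) (1 : ℂ)) +
          vecMulVec (Pi.single (l.1, t.2.2) (1 : ℂ)) (Pi.single (l.2.1, t.1) (1 : ℂ))) q.1 q.2)
      (Sum.elim
        -- corrections A `(i,j)`: `∑_k (y_{(J,j)(K,k)} + y_{(J,k)(K,i)})`
        (fun p q =>
          (vecMulVec (Pi.single (l.1, p.2) (1 : ℂ))
              ((Pi.single l.2.1 (1 : ℂ) : Fin 2 → ℂ) ∘ (Prod.fst : Fin 2 × Fin s → Fin 2)) +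
            vecMulVec
              ((Pi.single l.1 (1 : ℂ) : Fin 2 → ℂ) ∘ (Prod.fst : Fin 2 × Fin s → Fin 2))
              (Pi.single (l.2.1, p.1) (1 : ℂ)))
            q.1 q.2)
        (Sum.elim
          -- corrections B `(j,k)`: `y_{(J,j)(K,k)}`
          (fun p q =>
            vecMulVec (Pi.single (l.1, p.1) (1 : ℂ)) (Pi.single (l.2.1, p.2) (1 : ℂ)) q.1 q.2)
          -- corrections C `(k,i)`: `- y_{(J,k)(K,i)}`
          (fun p q =>
            vecMulVec (Pi.single (l.1, p.1) (-1 : ℂ)) (Pi.single (l.2.1, p.2) (1 : ℂ))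
              q.1 q.2))) l.2.2, ?_, ?_⟩
  · -- the tensor identity, checked on trilinear forms
    apply tensor_eq_of_forall_trilinear_eq
    intro z x y
    rw [trilinear_matMulTensorOn, trilinear_sum_triad, sum_pan_index]
    simp only [Sum.elim_inl, Sum.elim_inr, sum_leg_two_mul, sum_leg_one_mul,
      sum_single_mul_single_mul, sum_single_mul_block_mul, sum_block_mul_single_mul,
      one_mul, neg_one_mul]
    simp only [pan_pair_identity]
    simp only [Fintype.sum_prod_type, Fin.sum_univ_two, Finset.sum_add_distrib]
    ring
  · -- the rank bounds: every leg is `a bᵀ + c dᵀ` or `a bᵀ`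
    rintro ⟨J, K, (⟨i, j, k⟩ | ⟨i, j⟩ | ⟨j, k⟩ | ⟨k, i⟩)⟩
    · exact ⟨rank_leg_two_le _ _ _ _, rank_leg_two_le _ _ _ _, rank_leg_two_le _ _ _ _⟩
    · exact ⟨rank_leg_one_le _ _, rank_leg_one_le _ _, rank_leg_two_le _ _ _ _⟩
    · exact ⟨rank_leg_two_le _ _ _ _, rank_leg_one_le _ _, rank_leg_one_le _ _⟩
    · exact ⟨rank_leg_one_le _ _, rank_leg_two_le _ _ _ _, rank_leg_one_le _ _⟩

end Core

/-- **`PanTwoFold`** (item stmt-MatrixMultiplication-7539 of route ProbeRankScaling): for every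
`s` there is an explicit decomposition of `⟨2s, 2s, 2s⟩` over `ℂ` into `4 (s³ + 3 s²)` triads
all of whose three legs have matrix rank `≤ 2` — Pan's two-fold aggregation applied to the four
pairs `{(0,J,K), (1,J,K)}` of block products (Pan 1984, (4.1)–(4.3)). [folklore] -/
theorem panTwoFold_proof :
    Summit.MatrixMultiplication.MatrixMultiplication.Theses.ProbeRankScaling.PanTwoFold := by
  intro s
  obtain ⟨w, u, v, hdec, hrank⟩ := pan_core s
  -- enumerate the term index set and relabel `Fin (2 s)` as `Fin 2 × Fin s`
  set eσ := (Fintype.equivFinOfCardEq (card_pan_index s)).symm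
  set e : Fin (2 * s) ≃ Fin 2 × Fin s := finProdFinEquiv.symm
  refine ⟨fun l p => w (eσ l) (Prod.map e e p), fun l p => u (eσ l) (Prod.map e e p),
    fun l p => v (eσ l) (Prod.map e e p), ?_, ?_⟩
  · funext a b c
    have h1 : matMulTensor ℂ (2 * s) (2 * s) (2 * s) a b c =
        matMulTensorOn ℂ (Fin 2 × Fin s) (Fin 2 × Fin s) (Fin 2 × Fin s)
          (Prod.map e e a) (Prod.map e e b) (Prod.map e e c) := by
      rw [matMulTensorOn_reindex, matMulTensorOn_fin]
    rw [h1, hdec]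
    simp only [Finset.sum_apply, triad_apply]
    exact (Equiv.sum_comp eσ fun l => w l (Prod.map e e a) * u l (Prod.map e e b) *
      v l (Prod.map e e c)).symm
  · intro l
    have hsub : ∀ f : (Fin 2 × Fin s) × (Fin 2 × Fin s) → ℂ,
        Matrix.of (Function.curry fun p : Fin (2 * s) × Fin (2 * s) => f (Prod.map e e p)) =
          (Matrix.of (Function.curry f)).submatrix e e := fun f => rfl
    refine ⟨?_, ?_, ?_⟩
    · rw [hsub (w (eσ l)), Matrix.rank_submatrix]; exact (hrank _).1
    · rw [hsub (u (eσ l)), Matrix.rank_submatrix]; exact (hrank _).2.1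
    · rw [hsub (v (eσ l)), Matrix.rank_submatrix]; exact (hrank _).2.2

end Summit.MatrixMultiplication.MatrixMultiplication.Theorems
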